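import Summits.KontsevichZagierPeriods.KontsevichZagierPeriods.Theses.FurushoPentagon
import Summits.KontsevichZagierPeriods.KontsevichZagierPeriods.Theorems.FurushoPentagonStuffleInKZ
import Literature.NumberTheory.Transcendental.AssociatorsRegularisation
import Literature.NumberTheory.Transcendental.AssociatorsProofs
import Literature.NumberTheory.Transcendental.MZVShuffleRegularisationProofs
import Literature.NumberTheory.Transcendental.DrinfeldAssociatorRegularisation
import Literature.NumberTheory.Transcendental.KZRulesAssociator
import Literature.NumberTheory.Transcendental.DrinfeldAssociator

/-!
# `DoubleShuffleInKZ` (stmt-KontsevichZagierPeriods-14665, route `FurushoPentagon`): reduction to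
# IKZ's regularised family `Z(reg_ш(yᵐ ∗ w₀)) = 0`

Helper file (`--supports stmt-KontsevichZagierPeriods-14665`).  The support item `DoubleShuffleInKZ`
asks, for every realisation `χ` of the Kontsevich–Zagier rules into a commutative `ℚ`-algebra `R`
and every assignment `Z` pinned to Kontsevich's simplex classes, that the `χ`-valued
shuffle-regularised multiple-zeta series
`Φ_{χ,Z} = Σ_W (−1)^{#X₁(W)} ⟨ψ, reg_ш W⟩ W` (`ψ(v) = χ(Z(index of v))` on convergent words `v`,
`reg_ш = MZV.shuffleReg`) satisfy Furusho's generalised double shuffle relation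
`Δ_*(Φ_*) = Φ_* ⊗̂ Φ_*` (`NCSeries.GeneralisedDoubleShuffle`).

PURE ALGEBRA proved here (Furusho 2011 §4 = the tree's `NCSeries.generalisedDoubleShuffle_of_piY`,
plus IKZ 2006 §3): the four inputs of that reduction are, for `Φ_{χ,Z}`,
* `c_∅ = 1` — `χ[pt, 1] = 1` by the unit law of the Fubini product modulo relations;
* `c_{X₁ʲ} = 0` (`j ≥ 1`) — `reg_ш(X₁ʲ) = 0`, since `reg_ш` is a `ш`-homomorphism killing `X₁` and
  `X₁ ш X₁ʲ = (j+1) X₁ʲ⁺¹` (`shuffleReg_replicate_true`);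
* the convergent stuffle `c_s(π_Y Φ) c_t(π_Y Φ) = Σ_{u ∈ s ∗ t} c_u(π_Y Φ)` — this IS the proved crux
  `StuffleInKZ` pushed through `χ` (`c_s(π_Y Φ) = χ(Z s)` on admissible `s`);
* the regularised family `Σ_{u ∈ s ∗ 1ˡ} c_u(π_Y Φ) = 0` (`s ≠ ∅` admissible, `l ≥ 1`) — and
  `c_u(π_Y Φ) = ⟨ψ, reg_ш(binaryWord u)⟩ = χ(Z(reg_ш(u)))`, so this is LITERALLY property (v) of
  [IharaKanekoZagier2006, Thm 2]: `Z_R(reg_ш(yˡ ∗ w₀)) = 0` for all `l ≥ 1`, `w₀ ∈ 𝔥⁰`, in realisation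
  form.  Its instance `l = 1` is Hoffman's relation (the proved crux `HoffmanRelationInKZ`).

Hence (`doubleShuffleInKZ_of_regularisedFamily`): **`DoubleShuffleInKZ` follows from IKZ's family (v)
alone** — no pentagon, no reducedness of the period ring, no Furusho transfer.  Conversely the family
is an instance of the deliverable, so the two are equivalent given the tree; what is NOT in the tree is
(v) for `l ≥ 2` (equivalently, by [IharaKanekoZagier2006, Thm 3], the derivation relations `∂ₙ`,
`n ≥ 2`, inside the KZ calculus), and `FDS + (v)_{l=1} ⇒ (v)` is IKZ's conjectural statement (3), not a
theorem.

References: K. Ihara, M. Kaneko, D. Zagier, Compos. Math. 142 (2006), §3 Thm 2 (v), Cor. 5;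
H. Furusho, Ann. of Math. 174 (2011), §4; M. E. Hoffman, J. Algebra 194 (1997), §2.
-/

noncomputable section

open scoped BigOperators
open Literature.NumberTheory.Transcendental
open Summit.KontsevichZagierPeriods.KontsevichZagierPeriods.Theses.FurushoPentagon

namespace Summit.KontsevichZagierPeriods.FurushoPentagon.DoubleShuffleInKZ

/-! ## 1. `reg_ш(X₁ʲ) = 0` (the word bookkeeping `MZV.count_true_binaryWord`,
`MZV.isConvergentWord_binaryWord` is in the Literature files) -/

/-- **`reg_ш(X₁ʲ) = 0` for `j ≥ 1`**: `reg_ш` is a `ш`-homomorphism with `reg_ш(X₁) = 0`, and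
`X₁ ш X₁ʲ = (j + 1) X₁ʲ⁺¹` over `ℚ`. [cite: IharaKanekoZagier2006, §3 p. 314 (reg_ш(yᵐ) = 0)] -/
theorem shuffleReg_replicate_true (n : ℕ) : MZV.shuffleReg (List.replicate (n + 1) true) = 0 := by
  induction n with
  | zero => exact MZV.shuffleReg_y
  | succ n ih =>
    have h := MZV.shuffleRegFS_shuffleSum [true] (List.replicate (n + 1) true)
    rw [MZV.shuffleReg_y, MZV.shuffleSum, MZV.shuffleRegFS_wordSum,
      NCSeries.shuffleWord_singleton_replicate, List.map_replicate, List.sum_replicate] at h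
    have h0 : MZV.shuffleFS 0 (MZV.shuffleReg (List.replicate (n + 1) true)) = 0 := by
      simp [MZV.shuffleFS]
    rw [h0, ← Nat.cast_smul_eq_nsmul ℚ, smul_eq_zero] at h
    exact h.resolve_left (Nat.cast_ne_zero.mpr (Nat.succ_ne_zero _))

/-! ## 2. The series `Φ = Σ_W (−1)^{#X₁(W)} ⟨ψ, reg_ш W⟩ W` of a function `ψ` on words -/

section Series

variable {R : Type} [CommRing R] [Algebra ℚ R]

/-- `π_Y` of the series on an index with positive entries: the two signs `(−1)^{depth}` cancel,
`c_u(π_Y Φ) = ⟨ψ, reg_ш(binaryWord u)⟩`. [cite: Furusho2011, §2 (π_Y)] -/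
theorem piY_series (ψ : List Bool → R) (Φ : NCSeries Bool R)
    (hΦ : ∀ W, Φ W = (-1 : R) ^ (W.count true) * Shuffle.pair ψ (MZV.shuffleReg W))
    {u : List ℕ} (hu : ∀ i ∈ u, 1 ≤ i) :
    NCSeries.piY Φ u = Shuffle.pair ψ (MZV.shuffleReg (MZV.binaryWord u)) := by
  rw [NCSeries.piY_apply_of_forall_pos Φ hu, hΦ, MZV.count_true_binaryWord, ← mul_assoc, ← pow_add,
    ← two_mul, pow_mul, neg_one_sq, one_pow, one_mul]

/-- On an admissible index `reg_ш` does nothing: `⟨ψ, reg_ш(binaryWord s)⟩ = ψ(binaryWord s)`.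
[cite: IharaKanekoZagier2006, §3 p. 314 (reg_ш is the identity on 𝔥⁰)] -/
theorem pair_shuffleReg_binaryWord (ψ : List Bool → R) {s : List ℕ} (hs : MZV.IsAdmissible s) :
    Shuffle.pair ψ (MZV.shuffleReg (MZV.binaryWord s)) = ψ (MZV.binaryWord s) := by
  rw [MZV.shuffleReg_of_isConvergentWord (MZV.isConvergentWord_binaryWord hs), Shuffle.pair_single,
    one_smul]

/-- **Furusho's Part A for the series of a function on words.** Let `ψ : {words} → R` with
`ψ(∅) = 1`, agreeing on the binary words of admissible indices with a function `c` on indices that is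
`∗`-multiplicative on admissible pairs, and suppose IKZ's regularised family
`Σ_{u ∈ s ∗ 1ˡ} ⟨ψ, reg_ш(binaryWord u)⟩ = 0` (`s ≠ ∅` admissible, `l ≥ 1`). Then
`Φ = Σ_W (−1)^{#X₁(W)} ⟨ψ, reg_ш W⟩ W` satisfies the generalised double shuffle relation.
[cite: Furusho2011, §4 (Prop. 4.2 and end of proof of Thm 2.1)] -/
theorem generalisedDoubleShuffle_series (ψ : List Bool → R) (c : List ℕ → R) (Φ : NCSeries Bool R)
    (hΦ : ∀ W, Φ W = (-1 : R) ^ (W.count true) * Shuffle.pair ψ (MZV.shuffleReg W))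
    (h0 : ψ [] = 1)
    (hc : ∀ s, MZV.IsAdmissible s → ψ (MZV.binaryWord s) = c s)
    (hst : ∀ s t, MZV.IsAdmissible s → MZV.IsAdmissible t →
      c s * c t = ((MZV.stuffle s t).map c).sum)
    (hV : ∀ s, MZV.IsAdmissible s → s ≠ [] → ∀ l, 1 ≤ l →
      ((MZV.stuffle s (List.replicate l 1)).map fun u =>
        Shuffle.pair ψ (MZV.shuffleReg (MZV.binaryWord u))).sum = 0) :
    NCSeries.GeneralisedDoubleShuffle Φ := by
  have hpi : ∀ {u : List ℕ}, (∀ i ∈ u, 1 ≤ i) →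
      NCSeries.piY Φ u = Shuffle.pair ψ (MZV.shuffleReg (MZV.binaryWord u)) :=
    fun hu => piY_series ψ Φ hΦ hu
  have hadm : ∀ {s : List ℕ}, MZV.IsAdmissible s → NCSeries.piY Φ s = c s := fun hs => by
    rw [hpi hs.1, pair_shuffleReg_binaryWord ψ hs, hc _ hs]
  refine NCSeries.generalisedDoubleShuffle_of_piY ?_ ?_ ?_ ?_
  · rw [hΦ, List.count_nil, pow_zero, one_mul, MZV.shuffleReg_of_isConvergentWord (Or.inl rfl),
      Shuffle.pair_single, one_smul, h0]
  · intro j hj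
    obtain ⟨n, rfl⟩ : ∃ n, j = n + 1 := ⟨j - 1, by omega⟩
    rw [hΦ, shuffleReg_replicate_true, Shuffle.pair_zero, mul_zero]
  · intro s t hs ht
    rw [hadm hs, hadm ht, hst s t hs ht]
    exact congrArg List.sum (List.map_congr_left fun u hu =>
      (hadm (MZV.isAdmissible_of_mem_stuffle hs ht hu)).symm)
  · intro s hs hne l hl
    refine Eq.trans (congrArg List.sum (List.map_congr_left fun u hu => ?_)) (hV s hs hne l hl)
    exact hpi (MZV.one_le_of_mem_stuffle s _ hs.1 (fun i hi => by rw [List.eq_of_mem_replicate hi]) u hu)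

end Series

/-! ## 3. The reduction of the route item -/

/-- **`DoubleShuffleInKZ` from the convergent stuffle and IKZ's regularised family.** If
`StuffleInKZ` holds (it does: `StuffleInKZ.StuffleInKZ_of`) and, for every realisation `χ` of the
rules and every pinned `Z`, IKZ's property (v) `Σ_{u ∈ s ∗ 1ˡ} χ(Z(reg_ш u)) = 0` holds for all
non-empty admissible `s` and all `l ≥ 1` [IharaKanekoZagier2006, Thm 2 (v)], then the `χ`-valued
shuffle-regularised series satisfies Furusho's generalised double shuffle relation.
[cite: IharaKanekoZagier2006, Thm 2 (v); Furusho2011, §4] -/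
theorem doubleShuffleInKZ_of_stuffle_of_regularisedFamily (hS : StuffleInKZ)
    (hV : ∀ (R : Type) [CommRing R] [Algebra ℚ R] (χ : KZ.FormalRep →+ R),
      (∀ c ∈ KZ.relations, χ c = 0) → (∀ a b : KZ.FormalRep, χ (a * b) = χ a * χ b) →
      (∃ u : KZ.FormalRep, χ u = 1) → ∀ Z : List ℕ → KZ.FormalRep,
      (∀ (u : List ℕ) (hu : MZV.IsAdmissible u), Z u = KZ.of (KZ.mzvRep u hu
        (KZ.mzvIntegrand_isSemialgebraicFunOn_holds u) (KZ.mzvIntegrand_integrableOn_holds u hu))) →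
      ∀ s : List ℕ, MZV.IsAdmissible s → s ≠ [] → ∀ l : ℕ, 1 ≤ l →
        ((MZV.stuffle s (List.replicate l 1)).map fun u =>
          (MZV.shuffleReg (MZV.binaryWord u)).sum fun v a =>
            a • (if MZV.IsConvergentWord v then χ (Z (MZV.ofBinaryWord v)) else (0 : R))).sum = 0) :
    DoubleShuffleInKZ := by
  intro R _ _ χ hrel hmul hunit Z hZ
  -- the unit: `χ (Z []) = χ [pt, 1] = 1`
  have hZ1 : χ (Z []) = 1 := by
    obtain ⟨u, hu⟩ := hunit
    have h := hrel _ (KZ.of_unit_mul_sub_mem_relations u)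
    rw [map_sub, sub_eq_zero, hmul, hu, mul_one] at h
    rw [hZ [] MZV.isAdmissible_nil, KZ.mzvRep_nil]
    exact h
  refine generalisedDoubleShuffle_series
    (fun v => if MZV.IsConvergentWord v then χ (Z (MZV.ofBinaryWord v)) else 0)
    (fun s => χ (Z s)) _ (fun W => rfl) ?_ ?_ ?_ ?_
  · show (if MZV.IsConvergentWord [] then χ (Z (MZV.ofBinaryWord [])) else 0) = 1
    rw [if_pos (show MZV.IsConvergentWord [] from Or.inl rfl), MZV.ofBinaryWord_nil, hZ1]
  · intro s hs
    show (if MZV.IsConvergentWord (MZV.binaryWord s) then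
      χ (Z (MZV.ofBinaryWord (MZV.binaryWord s))) else 0) = χ (Z s)
    rw [if_pos (MZV.isConvergentWord_binaryWord hs), MZV.ofBinaryWord_binaryWord hs.1]
  · intro s t hs ht
    have h := hrel _ (hS Z hZ s t hs ht)
    rw [map_sub, sub_eq_zero, hmul, map_list_sum, List.map_map] at h
    exact h
  · intro s hs hne l hl
    exact hV R χ hrel hmul hunit Z hZ s hs hne l hl

/-- **`DoubleShuffleInKZ` ⇐ IKZ's regularised family (v) alone** (the convergent stuffle being the
proved crux `StuffleInKZ`): for the deliverable of route FurushoPentagon it suffices that, for every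
realisation `χ` of the rules and every pinned `Z`, `Σ_{u ∈ s ∗ 1ˡ} χ(Z(reg_ш u)) = 0` for all
non-empty admissible `s` and `l ≥ 1` — Hoffman's relation being the case `l = 1`.
[cite: IharaKanekoZagier2006, Thm 2 (v)] -/
theorem doubleShuffleInKZ_of_regularisedFamily
    (hV : ∀ (R : Type) [CommRing R] [Algebra ℚ R] (χ : KZ.FormalRep →+ R),
      (∀ c ∈ KZ.relations, χ c = 0) → (∀ a b : KZ.FormalRep, χ (a * b) = χ a * χ b) →
      (∃ u : KZ.FormalRep, χ u = 1) → ∀ Z : List ℕ → KZ.FormalRep,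
      (∀ (u : List ℕ) (hu : MZV.IsAdmissible u), Z u = KZ.of (KZ.mzvRep u hu
        (KZ.mzvIntegrand_isSemialgebraicFunOn_holds u) (KZ.mzvIntegrand_integrableOn_holds u hu))) →
      ∀ s : List ℕ, MZV.IsAdmissible s → s ≠ [] → ∀ l : ℕ, 1 ≤ l →
        ((MZV.stuffle s (List.replicate l 1)).map fun u =>
          (MZV.shuffleReg (MZV.binaryWord u)).sum fun v a =>
            a • (if MZV.IsConvergentWord v then χ (Z (MZV.ofBinaryWord v)) else (0 : R))).sum = 0) :
    DoubleShuffleInKZ :=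
  doubleShuffleInKZ_of_stuffle_of_regularisedFamily StuffleInKZ.StuffleInKZ_of hV

/-! ## 4. The converse: the deliverable contains IKZ's family -/

section Converse

variable {R : Type} [CommRing R] [Algebra ℚ R]

/-- **The generalised double shuffle relation implies IKZ's regularised family** (converse of the last
input of `NCSeries.generalisedDoubleShuffle_of_piY`): if `c_∅(Φ) = 1`, `c_{X₁ʲ}(Φ) = 0` (`j ≥ 1`) and
`Δ_*(Φ_*) = Φ_* ⊗̂ Φ_*`, then `Σ_{u ∈ s ∗ 1ˡ} c_u(π_Y Φ) = 0` for `s ≠ ∅` admissible and `l ≥ 1`: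
unfolding `Φ_* = Φ_corr · π_Y Φ` in `c_s(Φ_*) c_{1ˡ}(Φ_*) = Σ_{u ∈ s ∗ 1ˡ} c_u(Φ_*)` gives the
unitriangular system `Σ_{j < l} c_{Y₁ʲ}(Φ_corr) F(l − j) = 0` for `F(m) = Σ_{u ∈ s ∗ 1ᵐ} c_u(π_Y Φ)`.
[cite: Furusho2011, §4; IharaKanekoZagier2006, Thm 2 (v)] -/
theorem sumStuffle_replicate_one_eq_zero_of_generalisedDoubleShuffle {Φ : NCSeries Bool R}
    (h0 : Φ [] = 1) (h1 : ∀ j, 1 ≤ j → Φ (List.replicate j true) = 0)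
    (h : NCSeries.GeneralisedDoubleShuffle Φ) {s : List ℕ} (hs : MZV.IsAdmissible s) (hne : s ≠ [])
    {l : ℕ} (hl : 1 ≤ l) :
    ((MZV.stuffle s (List.replicate l 1)).map (NCSeries.piY Φ)).sum = 0 := by
  obtain ⟨a, s', rfl⟩ := List.exists_cons_of_ne_nil hne
  have ha : 2 ≤ a := by simpa using hs.2 (List.cons_ne_nil a s')
  have hones : ∀ m : ℕ, ∀ i ∈ List.replicate m 1, 1 ≤ i := fun m i hi => by
    rw [List.eq_of_mem_replicate hi]
  -- the unfolded form of `Φ_*`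
  have hF : NCSeries.seriesShuffleReg Φ = fun u => ∑ p ∈ NCSeries.splits u,
      if (∀ i ∈ p.1, i = 1) then NCSeries.corr Φ (List.replicate p.1.length 1) * NCSeries.piY Φ p.2
        else 0 :=
    funext (NCSeries.seriesShuffleReg_apply_eq_sum_splits Φ)
  -- the triangular system: `Σ_{j < m} c_{Y₁ʲ}(Φ_corr) F(m - j) = 0` for `m ≥ 1`
  have hsys : ∀ m : ℕ, ∑ j ∈ Finset.range m, NCSeries.corr Φ (List.replicate j 1) *
      MZV.sumStuffle (NCSeries.piY Φ) (a :: s') (List.replicate (m - j) 1) = 0 := by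
    intro m
    have hG := h (a :: s') (List.replicate m 1) hs.1 (hones m)
    rw [NCSeries.seriesShuffleReg_apply_of_isAdmissible Φ hs,
      NCSeries.seriesShuffleReg_apply_replicate_one h0 h1, hF] at hG
    change _ = MZV.sumStuffle _ (a :: s') (List.replicate m 1) at hG
    rw [NCSeries.sumStuffle_replicate_one_splits (fun j => NCSeries.corr Φ (List.replicate j 1))
      (NCSeries.piY Φ) ha s' m, Finset.sum_range_succ, Nat.sub_self, List.replicate_zero,
      MZV.sumStuffle_nil_right, NCSeries.piY_apply_of_forall_pos Φ hs.1] at hG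
    -- hG : x * c = S + c * x
    have := hG
    linear_combination -this
  -- strong induction on `m`
  suffices H : ∀ n m : ℕ, 1 ≤ m → m ≤ n →
      MZV.sumStuffle (NCSeries.piY Φ) (a :: s') (List.replicate m 1) = 0 from H l l hl le_rfl
  intro n
  induction n with
  | zero => intro m hm hmn; omega
  | succ n ih =>
    intro m hm hmn
    rcases Nat.lt_or_ge m (n + 1) with hlt | hge
    · exact ih m hm (by omega)
    obtain ⟨k, rfl⟩ : ∃ k, m = k + 1 := ⟨m - 1, by omega⟩
    have hk := hsys (k + 1)
    rw [Finset.sum_range_succ', List.replicate_zero, NCSeries.corr_apply_nil, one_mul, Nat.sub_zero,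
      Finset.sum_eq_zero fun j hj => ?_, zero_add] at hk
    · exact hk
    · rw [Finset.mem_range] at hj
      rw [ih (k + 1 - (j + 1)) (by omega) (by omega), mul_zero]

/-- **`DoubleShuffleInKZ` implies IKZ's regularised family (v)** for every realisation and every
pinned assignment: the hypothesis of `doubleShuffleInKZ_of_regularisedFamily` is also NECESSARY, so the
route's deliverable is EQUIVALENT (given the tree) to property (v) of [IharaKanekoZagier2006, Thm 2] in
realisation form. [cite: IharaKanekoZagier2006, Thm 2 (v)] -/
theorem regularisedFamily_of_doubleShuffleInKZ (hD : DoubleShuffleInKZ) :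
    ∀ (R : Type) [CommRing R] [Algebra ℚ R] (χ : KZ.FormalRep →+ R),
      (∀ c ∈ KZ.relations, χ c = 0) → (∀ a b : KZ.FormalRep, χ (a * b) = χ a * χ b) →
      (∃ u : KZ.FormalRep, χ u = 1) → ∀ Z : List ℕ → KZ.FormalRep,
      (∀ (u : List ℕ) (hu : MZV.IsAdmissible u), Z u = KZ.of (KZ.mzvRep u hu
        (KZ.mzvIntegrand_isSemialgebraicFunOn_holds u) (KZ.mzvIntegrand_integrableOn_holds u hu))) →
      ∀ s : List ℕ, MZV.IsAdmissible s → s ≠ [] → ∀ l : ℕ, 1 ≤ l →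
        ((MZV.stuffle s (List.replicate l 1)).map fun u =>
          (MZV.shuffleReg (MZV.binaryWord u)).sum fun v a =>
            a • (if MZV.IsConvergentWord v then χ (Z (MZV.ofBinaryWord v)) else (0 : R))).sum = 0 := by
  intro R _ _ χ hrel hmul hunit Z hZ s hs hne l hl
  have hG := hD R χ hrel hmul hunit Z hZ
  set ψ : List Bool → R := fun v => if MZV.IsConvergentWord v then χ (Z (MZV.ofBinaryWord v)) else 0
    with hψ
  set Φ : NCSeries Bool R := fun W => (-1 : R) ^ (W.count true) * Shuffle.pair ψ (MZV.shuffleReg W)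
    with hΦdef
  have hΦ : ∀ W, Φ W = (-1 : R) ^ (W.count true) * Shuffle.pair ψ (MZV.shuffleReg W) := fun W => rfl
  change NCSeries.GeneralisedDoubleShuffle Φ at hG
  -- `c_∅(Φ) = 1` and `c_{X₁ʲ}(Φ) = 0`
  have hZ1 : χ (Z []) = 1 := by
    obtain ⟨u, hu⟩ := hunit
    have h := hrel _ (KZ.of_unit_mul_sub_mem_relations u)
    rw [map_sub, sub_eq_zero, hmul, hu, mul_one] at h
    rw [hZ [] MZV.isAdmissible_nil, KZ.mzvRep_nil]
    exact h
  have h0 : Φ [] = 1 := by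
    rw [hΦ, List.count_nil, pow_zero, one_mul, MZV.shuffleReg_of_isConvergentWord (Or.inl rfl),
      Shuffle.pair_single, one_smul, hψ]
    show (if MZV.IsConvergentWord [] then χ (Z (MZV.ofBinaryWord [])) else 0) = 1
    rw [if_pos (show MZV.IsConvergentWord [] from Or.inl rfl), MZV.ofBinaryWord_nil, hZ1]
  have h1 : ∀ j, 1 ≤ j → Φ (List.replicate j true) = 0 := by
    intro j hj
    obtain ⟨n, rfl⟩ : ∃ n, j = n + 1 := ⟨j - 1, by omega⟩
    rw [hΦ, shuffleReg_replicate_true, Shuffle.pair_zero, mul_zero]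
  have key := sumStuffle_replicate_one_eq_zero_of_generalisedDoubleShuffle h0 h1 hG hs hne hl
  refine Eq.trans (congrArg List.sum (List.map_congr_left fun u hu => ?_)) key
  exact (piY_series ψ Φ hΦ
    (MZV.one_le_of_mem_stuffle s _ hs.1 (fun i hi => by rw [List.eq_of_mem_replicate hi]) u hu)).symm

end Converse

end Summit.KontsevichZagierPeriods.FurushoPentagon.DoubleShuffleInKZ
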